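import Literature.AlgebraicGeometry.HodgeTheory.CurveHodgeGenusBound
import Literature.AlgebraicGeometry.Motives.JacobianDimensionOfBirationalSymmetricPower
import HarnessLib

/-!
# The Jacobian dimension fact `2 dim J = b₁(C(ℂ))` from Weil's construction data
# (Milne, *Jacobian Varieties*, Prop. 2.1 from Thm. 5.1 (a))

The named fact `Literature.AlgebraicGeometry.Motives.two_mul_dim_eq_finrank_bettiCohomology`
(`Motives/Jacobian`: `2 dim J = b₁(C(ℂ))` for every Jacobian `𝒥 : Jacobian C`, in the tree's
universal-property sense, of every smooth projective complex curve; Milne Prop. 2.1 with the genus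
read off topologically) has been reduced in this tree to the ALGEBRAIC inequality `g(C) ≤ dim J`
(`HodgeTheory/CurveHodgeGenusBound`: `two_mul_dim_eq_finrank_bettiCohomology_of_forall_curveGenus_le_dim`,
after `dim J ≤ h^{1,0}(C) ≤ g(C)` unconditionally, `g(C)` the genus of the function field). This file
closes the bookkeeping between that reduction and the Jacobian-existence programme of
`Motives/JacobianOfBirationalSymmetricPower` / `Motives/JacobianExistenceSplit`, whose named facts
(`nonempty_jacobian_of_algPoints`, `jacobian_galoisDescent`) are `Nonempty`-valued and carry no
dimension:

* `two_mul_dim_eq_finrank_bettiCohomology_of_forall_exists_curveGenus_le_dim` — since all Jacobians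
  of `C` have the same dimension (`Jacobian.dim_eq_dim`, Milne Remark 6.5), the fact follows as soon
  as every smooth projective complex curve that has a Jacobian has ONE Jacobian of dimension
  `≥ g(C)`;
* `two_mul_dim_eq_finrank_bettiCohomology_of_forall_exists_symPowChart` — in particular it follows
  from **Milne Thm. 5.1 (a) in the form consumed by `Jacobian.nonempty_of_isOpenImmersion_symPow`**:
  for every such curve, a rational point `P`, an abelian variety `J` with `f : C → J`, `f(P) = 0`,
  an affine open `U ∋ P` and a non-empty open `V ⊆ U⁽ᵐ⁺¹⁾` on which `f^{(m+1)}` is an open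
  immersion, with `g(C) ≤ m + 1` (`Jacobian.dim_eq_of_isSmoothProjective_of_isOpenImmersion_symPow`:
  `dim 𝒥 = m + 1` for every Jacobian `𝒥`);
* `curveGenus_eq_dim_of_isOpenImmersion_symPow` — per curve, such data force `m + 1 = g(C) = dim 𝒥`
  (`dim 𝒥 ≤ g(C)` being unconditional, `Jacobian.dim_le_curveGenus`);
* `Schoen1988_cyclicPrym_weilClasses_algebraic_degreeSix_of_forall_exists_curveGenus_le_dim_of_exists_weilClass`
  — Schoen's degree-six fact (`HodgeTheory/WeilClassesCyclicPrym`) from [a Jacobian of dimension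
  `≥ g(C)` for the Schoen curves] and [one non-zero algebraic class in the Weil plane].

Everything is proved; no named facts and no definitions are introduced (D-0026).

## References

* J. S. Milne, *Jacobian Varieties*, in G. Cornell, J. H. Silverman (eds.), *Arithmetic Geometry*
  (1986), Ch. VII: Prop. 2.1, §5 Thm. 5.1 (a), §6 Prop. 6.1, Prop. 6.4, Remark 6.5, §7.
  [Milne1986JacobianVarieties]
* C. Schoen, Hodge classes on self-products of a variety with an automorphism, Compositio Math. 65
  (1988), 3–32: Thm. 2.0 (p. 11), Cor. 3.1 (p. 24). [Schoen1988HodgeWeil]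
-/

noncomputable section

universe u

open CategoryTheory AlgebraicGeometry
open Literature.AlgebraicGeometry.Motives
open Literature.AlgebraicGeometry.RelativeSpec
open scoped MonObj

namespace Literature.AlgebraicGeometry.HodgeTheory

/-! ### The fact from one Jacobian of dimension `≥ g(C)` per curve -/

/-- **`two_mul_dim_eq_finrank_bettiCohomology` from one Jacobian of dimension `≥ g(C)` per curve.**
If every smooth projective complex curve `C` which has a Jacobian has SOME Jacobian `𝒥'` with
`g(C) ≤ dim 𝒥'.J` (`g(C)` the genus of the function field, `CurvePlaces.curveGenus`), then
`2 dim J = b₁(C(ℂ))` for every Jacobian of every such curve: all Jacobians of `C` have the same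
dimension (`Jacobian.dim_eq_dim`, Milne Remark 6.5) and
`two_mul_dim_eq_finrank_bettiCohomology_of_forall_curveGenus_le_dim`. The hypothesis is the
dimension statement of Milne Prop. 2.1 for one (e.g. Weil's) construction of the Jacobian.
[cite: Milne1986JacobianVarieties, §2 Prop. 2.1 and §6 Remark 6.5] -/
theorem two_mul_dim_eq_finrank_bettiCohomology_of_forall_exists_curveGenus_le_dim
    (h : ∀ (C : SchemeOver ℂ) [IsIntegral C.left] [SmoothOfRelativeDimension 1 C.hom]
      [IsProper C.hom], IsSmoothProjective 1 C → Nonempty (Jacobian C) →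
      ∃ 𝒥' : Jacobian C, CurvePlaces.curveGenus C ≤ 𝒥'.J.dim) :
    Motives.two_mul_dim_eq_finrank_bettiCohomology := by
  refine two_mul_dim_eq_finrank_bettiCohomology_of_forall_curveGenus_le_dim fun C _ _ _ hC 𝒥 ↦ ?_
  obtain ⟨𝒥', h'⟩ := h C hC ⟨𝒥⟩
  rwa [Jacobian.dim_eq_dim 𝒥 𝒥']

/-! ### The fact from Milne's Thm. 5.1 (a) data -/

/-- **Per curve: Weil's data force `m + 1 = g(C) = dim 𝒥`.** For a smooth projective complex curve
`C` with `P ∈ C(ℂ)`, `f : C → J`, `f(P) = 0`, `U ∋ P` affine open and `f^{(m+1)} : U⁽ᵐ⁺¹⁾ → J` an open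
immersion on a non-empty open `V`, with `g(C) ≤ m + 1`: every Jacobian `𝒥` of `C` has
`dim 𝒥.J = m + 1 = g(C)` (`Jacobian.dim_eq_of_isSmoothProjective_of_isOpenImmersion_symPow` and
the unconditional `dim 𝒥 ≤ g(C)`, `Jacobian.dim_le_curveGenus`). [cite: Milne1986JacobianVarieties, §2 Prop. 2.1 and §5 Thm. 5.1 (a)] -/
theorem curveGenus_eq_dim_of_isOpenImmersion_symPow {C : SchemeOver ℂ} [IsIntegral C.left]
    (hC : IsSmoothProjective 1 C) (𝒥 : Jacobian C) (P : AlgPoints C ℂ) (J : AbelianVariety ℂ) (f : C ⟶ J.X) (hf : P ≫ f = 1)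
    (m : ℕ) (U : C.left.Opens) [IsAffine U] (PU : specOver ℂ ℂ ⟶ pieceOver U)
    (hPU : PU ≫ pieceι U = P) (V : (symPow (U.ι ≫ C.hom) (m + 1)).Opens)
    (hV : (V : Set (symPow (U.ι ≫ C.hom) (m + 1))).Nonempty)
    [IsOpenImmersion (V.ι ≫ (sumDescOver U J f (m + 1)).left)]
    (hm : CurvePlaces.curveGenus C ≤ m + 1) :
    CurvePlaces.curveGenus C = 𝒥.J.dim ∧ 𝒥.J.dim = m + 1 := by
  have hdim : 𝒥.J.dim = m + 1 :=
    Jacobian.dim_eq_of_isSmoothProjective_of_isOpenImmersion_symPow hC 𝒥 P J f hf m U PU hPU V hV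
  haveI := hC.smoothOfRelativeDimension
  haveI : IsProper C.hom := IsSmoothProjective.isProper_holds hC
  have hle : 𝒥.J.dim ≤ CurvePlaces.curveGenus C := Jacobian.dim_le_curveGenus C hC 𝒥
  refine ⟨le_antisymm (hdim ▸ hm) hle, hdim⟩

/-- **`two_mul_dim_eq_finrank_bettiCohomology` from Milne's Thm. 5.1 (a)** in the form consumed by
`Jacobian.nonempty_of_isOpenImmersion_symPow` (`Motives/JacobianOfBirationalSymmetricPower`): if every
smooth projective complex curve `C` with a Jacobian admits a rational point `P`, an abelian variety
`J` with `f : C → J`, `f(P) = 0`, an affine open `U ∋ P`, and a non-empty open `V` of the symmetric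
power `U⁽ᵐ⁺¹⁾` on which `f^{(m+1)}` is an open immersion, for some `m` with `g(C) ≤ m + 1` (Weil's
construction: `m + 1 = g`, `f^{(g)}` birational), then `2 dim J = b₁(C(ℂ))` for all Jacobians of all
smooth projective complex curves. [cite: Milne1986JacobianVarieties, §2 Prop. 2.1, §5 Thm. 5.1 (a), §7] -/
theorem two_mul_dim_eq_finrank_bettiCohomology_of_forall_exists_symPowChart
    (h : ∀ (C : SchemeOver ℂ) [IsIntegral C.left], IsSmoothProjective 1 C → Nonempty (Jacobian C) →
      ∃ (P : AlgPoints C ℂ) (J : AbelianVariety ℂ) (f : C ⟶ J.X) (_ : P ≫ f = 1) (m : ℕ)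
        (U : C.left.Opens) (_ : IsAffine U) (PU : specOver ℂ ℂ ⟶ pieceOver U)
        (_ : PU ≫ pieceι U = P) (V : (symPow (U.ι ≫ C.hom) (m + 1)).Opens)
        (_ : (V : Set (symPow (U.ι ≫ C.hom) (m + 1))).Nonempty)
        (_ : IsOpenImmersion (V.ι ≫ (sumDescOver U J f (m + 1)).left)),
        CurvePlaces.curveGenus C ≤ m + 1) :
    Motives.two_mul_dim_eq_finrank_bettiCohomology := by
  refine two_mul_dim_eq_finrank_bettiCohomology_of_forall_exists_curveGenus_le_dim
    fun C _ _ _ hC h𝒥 ↦ ?_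
  obtain ⟨𝒥⟩ := h𝒥
  obtain ⟨P, J, f, hf, m, U, hU, PU, hPU, V, hV, hV', hm⟩ := h C hC ⟨𝒥⟩
  exact ⟨𝒥, ((curveGenus_eq_dim_of_isOpenImmersion_symPow hC 𝒥 P J f hf m U PU hPU V hV hm).1).le⟩

/-! ### Schoen's degree-six fact from the same data -/

/-- **Schoen's degree-`6` cyclic-Prym fact from [a Jacobian of dimension `≥ g(C)` for Schoen's
curves] and [one non-zero algebraic Weil class].** Hypothesis (i): for the curve `C` of the fact
(smooth projective, a Jacobian `𝒥` with `dim 𝒥.J = 25`, `α` of order `6` with `α²`, `α³`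
fixed-point free) SOME Jacobian `𝒥'` of `C` has `g(C) ≤ dim 𝒥'.J` (Milne Prop. 2.1 for one
construction; then `g(C) ≤ dim 𝒥.J` by `Jacobian.dim_eq_dim`, hence `h^{1,0}(C) ≤ dim 𝒥.J`,
`finrank_hodgeOneZero_le_dim_of_curveGenus_le_dim`); hypothesis (iii′): Schoen's cycle — one
non-zero algebraic class in the Weil plane `E₊ ⊔ E₋` of `(B, ψ₀)` (Cor. 3.1 with Thm. 2.0). Through
`Schoen1988_cyclicPrym_weilClasses_algebraic_degreeSix_of_finrank_hodgeOneZero_le_of_exists_weilClass`.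
[cite: Schoen1988HodgeWeil, Cor. 3.1 (p. 24) with Thm. 2.0 (p. 11)] [cite: Milne1986JacobianVarieties, §2 Prop. 2.1 and §6 Remark 6.5] -/
theorem Schoen1988_cyclicPrym_weilClasses_algebraic_degreeSix_of_forall_exists_curveGenus_le_dim_of_exists_weilClass
    (hg : ∀ (C : Motives.SchemeOver ℂ) (𝒥 : Jacobian C) (α : C ⟶ C),
      Motives.IsSmoothProjective 1 C → 𝒥.J.dim = 25 →
      α ≫ α ≫ α ≫ α ≫ α ≫ α = 𝟙 C →
      (∀ P : Motives.ComplexPoints C, P ≫ (α ≫ α) ≠ P ∧ P ≫ (α ≫ α ≫ α) ≠ P) →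
      ∀ [IsIntegral C.left], ∃ 𝒥' : Jacobian C, CurvePlaces.curveGenus C ≤ 𝒥'.J.dim)
    (hZ : ∀ (C : Motives.SchemeOver ℂ) (𝒥 : Jacobian C) (α : C ⟶ C),
      Motives.IsSmoothProjective 1 C → 𝒥.J.dim = 25 →
      α ≫ α ≫ α ≫ α ≫ α ≫ α = 𝟙 C →
      (∀ P : Motives.ComplexPoints C, P ≫ (α ≫ α) ≠ P ∧ P ≫ (α ≫ α ≫ α) ≠ P) →
    ∀ (s : 𝒥.J ⟶ 𝒥.J), s = 𝒥.pushforward 𝒥 α →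
    ∀ (sB ψ₀ : Motives.AbelianVariety.kerComponent (𝟙 𝒥.J - s + s ≫ s) ⟶
        Motives.AbelianVariety.kerComponent (𝟙 𝒥.J - s + s ≫ s)),
      sB ≫ Motives.AbelianVariety.kerComponentι (𝟙 𝒥.J - s + s ≫ s) =
        Motives.AbelianVariety.kerComponentι (𝟙 𝒥.J - s + s ≫ s) ≫ s →
      ψ₀ = 𝟙 _ + 2 • (sB ≫ sB) →
      ∃ c ∈ Module.End.eigenspace
            (complexBetti.map ((2 : ℤ) • 𝟙 (Motives.AbelianVariety.kerComponent (𝟙 𝒥.J - s + s ≫ s)) +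
              ψ₀).hom.hom.hom 8).hom ((2 + Complex.I * (Real.sqrt (3 : ℝ) : ℂ)) ^ 8) ⊔
          Module.End.eigenspace
            (complexBetti.map ((2 : ℤ) • 𝟙 (Motives.AbelianVariety.kerComponent (𝟙 𝒥.J - s + s ≫ s)) +
              ψ₀).hom.hom.hom 8).hom ((2 - Complex.I * (Real.sqrt (3 : ℝ) : ℂ)) ^ 8),
        c ∈ algebraicClasses (Motives.AbelianVariety.kerComponent (𝟙 𝒥.J - s + s ≫ s)).X 4 ∧ c ≠ 0) :
    Schoen1988_cyclicPrym_weilClasses_algebraic_degreeSix := by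
  refine Schoen1988_cyclicPrym_weilClasses_algebraic_degreeSix_of_finrank_hodgeOneZero_le_of_exists_weilClass
    (fun C 𝒥 α hC h25 hα hfree ↦ ?_) hZ
  refine finrank_hodgeOneZero_le_dim_of_curveGenus_le_dim hC 𝒥 ?_
  intro _ _ _
  obtain ⟨𝒥', h'⟩ := hg C 𝒥 α hC h25 hα hfree
  rwa [Jacobian.dim_eq_dim 𝒥 𝒥']

end Literature.AlgebraicGeometry.HodgeTheory

end
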